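import Mathlib
import Literature.Combinatorics.Enumerative.PatternAvoidanceSymmetries
import HarnessLib

/-!
# Superpatterns: a permutation of length `k^2` containing every pattern of length `k` (Arratia 1999, Theorem 2)

Layer `Literature/Combinatorics/Enumerative`, namespace `Literature.Combinatorics.Enumerative.PermContainsPattern` (API of
the tree notion `PermContainsPattern`); lane `lit-hodgefound` (Track 2 foundations library; prover seat p13, generation
37, theme «pattern avoidance»).

## Source, verbatim

R. Arratia, *On the Stanley–Wilf conjecture for the number of permutations avoiding a given pattern*, Electron. J.
Combin. 6 (1999) N1 [Arratia1999] (open access; read 2026-08-29, pp. 3–4):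

> As usual, say that `τ ∈ S_n` contains `σ ∈ S_k` as a subpattern if there exist `1 ≤ x_1 < ⋯ < x_k ≤ n` such that for
> `1 ≤ i, j ≤ k`, `τ(x_i) < τ(x_j)` if and only if `σ(i) < σ(j)`. (1) … Let `m(k)` be the least `n` such that some
> `τ ∈ S_n` contains every `σ ∈ S_k`. For a trivial lower bound on `m(k)`, since `τ ∈ S_n` contains at most `binom(n, k)`
> subpatterns, to contain every subpattern requires `binom(n, k) ≥ k!` …
> **Theorem 2.** There exists an `n`-permutation, with `n = k^2`, containing every `k`-permutation as a subpattern; i.e.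
> `m(k) ≤ k^2`.
> Proof. Consider the lexicographic order on `[k]^2` as a one-to-one map specifying the ranks of the ordered pairs, i.e.
> let `r : [k]^2 → [k^2]`, with `(i, j) ↦ (i − 1)k + j`. Also consider the transposed lexicographic order
> `t : [k]^2 → [k^2]` given by `t(i, j) := r(j, i)`. Consider the permutation `τ ∈ S_{k^2}` given by `τ = r ∘ t^{−1}`; for
> example, with `k = 3`, this is `τ = 147258369`. Then, clearly, `τ` contains every `σ ∈ S_k` as a subpattern. In
> detail, with the positions `x_1 := t(σ(1), 1), …, x_k := t(σ(k), k)` we have `x_1 < ⋯ < x_k` and for `m = 1` to `k`,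
> `τ(x_m) = (r ∘ t^{−1})(t(σ(m), m)) = r(σ(m), m)` so that `τ(x_a) < τ(x_b)` iff `σ(a) < σ(b)`.

## What is proved (theorems only; no `def`, no instance, no notation, no named fact — net debt 0)

* `eq_of_forall_lt_iff` — two permutations of `Fin k` with the same pairwise comparisons are equal (a permutation is
  determined by its pattern);
* ★ `factorial_le_choose_of_superpattern` — the «trivial lower bound»: if `τ ∈ S_n` contains every `σ ∈ S_k` then
  `k! ≤ binom(n, k)` (the positions of an occurrence determine the pattern);
* ★★ `exists_superpattern_sq` — THEOREM 2: the permutation `τ = r ∘ t^{−1}` of `Fin (k·k)` (written with Mathlib's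
  `finProdFinEquiv` and `Equiv.prodComm`: the cell `(i, j)` of the `k × k` grid read by rows goes to the same cell read by
  columns) contains every `σ ∈ S_k`, at the positions `x_m = t(σ(m), m)`.
-/

namespace Literature.Combinatorics.Enumerative

namespace PermContainsPattern

open Finset Equiv

variable {n k : ℕ}

/-- A permutation is determined by its pattern: if `σ a < σ b ↔ σ' a < σ' b` for all `a, b`, then `σ = σ'`.
[cite: Arratia1999, (1)] -/
theorem eq_of_forall_lt_iff {σ σ' : Perm (Fin k)} (h : ∀ a b : Fin k, σ a < σ b ↔ σ' a < σ' b) : σ = σ' := by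
  -- `σ' ∘ σ⁻¹` is a strictly increasing permutation, hence the identity
  have hm : StrictMono ⇑(σ' * σ⁻¹ : Perm (Fin k)) := by
    intro x y hxy
    simp only [Perm.coe_mul, Function.comp_apply]
    have := (h (σ⁻¹ x) (σ⁻¹ y)).mp (by simpa using hxy)
    exact this
  have e : ⇑(σ' * σ⁻¹ : Perm (Fin k)) = id :=
    (hm.range_inj strictMono_id).mp (by rw [Set.range_id]; exact Equiv.range_eq_univ _)
  have h1 : σ' * σ⁻¹ = 1 := Equiv.ext fun i => congrFun e i
  rw [mul_inv_eq_one] at h1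
  exact h1.symm

/-- ★ «to contain every subpattern requires `binom(n, k) ≥ k!`»: the set of positions of an occurrence determines the
pattern, so a permutation of length `n` containing all `k!` patterns of length `k` has `k! ≤ binom(n, k)`.
[cite: Arratia1999, §1 (trivial lower bound on m(k))] -/
theorem factorial_le_choose_of_superpattern {τ : Perm (Fin n)}
    (h : ∀ σ : Perm (Fin k), PermContainsPattern τ (fun a => (σ a : ℕ))) : k.factorial ≤ n.choose k := by
  classical
  choose f hf hfq using h
  have hinj : Set.InjOn (fun σ : Perm (Fin k) => (Finset.univ : Finset (Fin k)).map ⟨f σ, (hf σ).injective⟩)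
      ↑(Finset.univ : Finset (Perm (Fin k))) := by
    intro σ _ σ' _ hS
    have hrange : Set.range (f σ) = Set.range (f σ') := by
      have e1 : Set.range (f σ) = ↑((Finset.univ : Finset (Fin k)).map ⟨f σ, (hf σ).injective⟩) := by
        rw [Finset.coe_map]; simp
      have e2 : Set.range (f σ') = ↑((Finset.univ : Finset (Fin k)).map ⟨f σ', (hf σ').injective⟩) := by
        rw [Finset.coe_map]; simp
      rw [e1, e2]
      exact congrArg _ hS
    have hff : f σ = f σ' := ((hf σ).range_inj (hf σ')).mp hrange
    refine eq_of_forall_lt_iff fun a b => ?_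
    have h1 := hfq σ a b
    have h2 := hfq σ' a b
    rw [hff] at h1
    exact Fin.lt_def.trans ((h1.trans h2.symm).trans Fin.lt_def.symm)
  calc k.factorial = (Finset.univ : Finset (Perm (Fin k))).card := by
        rw [Finset.card_univ, Fintype.card_perm, Fintype.card_fin]
    _ ≤ ((Finset.univ : Finset (Fin n)).powersetCard k).card := by
        refine Finset.card_le_card_of_injOn _ (fun σ _ => ?_) hinj
        rw [Finset.mem_coe, Finset.mem_powersetCard]
        exact ⟨Finset.subset_univ _, by simp⟩
    _ = n.choose k := by rw [Finset.card_powersetCard, Finset.card_univ, Fintype.card_fin]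

/-- ★★ **THEOREM 2 (Arratia 1999)** «There exists an `n`-permutation, with `n = k^2`, containing every `k`-permutation as a
subpattern»: the grid permutation `τ = r ∘ t^{−1}` (`τ = 147258369` for `k = 3`), sending the position `t(i, j) = (j−1)k + i`
to the value `r(i, j) = (i−1)k + j`, contains `σ` at the positions `x_m = t(σ(m), m)`. [cite: Arratia1999, Theorem 2] -/
theorem exists_superpattern_sq (k : ℕ) :
    ∃ τ : Perm (Fin (k * k)), ∀ σ : Perm (Fin k), PermContainsPattern τ (fun a => (σ a : ℕ)) := by
  refine ⟨finProdFinEquiv.symm.trans ((Equiv.prodComm (Fin k) (Fin k)).trans finProdFinEquiv), fun σ => ?_⟩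
  -- position `x_m = t(σ m, m)` is the grid cell `(m, σ m)` read by rows: value `σ m + k·m`
  have hval : ∀ a b : Fin k, ((finProdFinEquiv (a, b) : Fin (k * k)) : ℕ) = b + k * a := fun a b => rfl
  have hτ : ∀ a b : Fin k, (finProdFinEquiv.symm.trans ((Equiv.prodComm (Fin k) (Fin k)).trans finProdFinEquiv))
      (finProdFinEquiv (a, b)) = finProdFinEquiv (b, a) := fun a b => by simp
  refine ⟨fun m => finProdFinEquiv (m, σ m), fun m m' hmm' => ?_, fun a b => ?_⟩
  · rw [Fin.lt_def, hval, hval]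
    have h1 : (σ m : ℕ) < k := (σ m).2
    have h2 : (m : ℕ) + 1 ≤ m' := Fin.lt_def.mp hmm'
    nlinarith
  · rw [hτ, hτ, Fin.lt_def, hval, hval]
    show (σ a : ℕ) < σ b ↔ _
    have ha : (a : ℕ) < k := a.2
    have hb : (b : ℕ) < k := b.2
    constructor
    · intro h
      have h1 : (σ a : ℕ) + 1 ≤ σ b := h
      nlinarith
    · intro h
      rcases lt_trichotomy (σ a) (σ b) with hab | hab | hab
      · exact Fin.lt_def.mp hab
      · have := σ.injective hab
        subst this
        exact absurd h (lt_irrefl _)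
      · exfalso
        have h1 : (σ b : ℕ) + 1 ≤ σ a := Fin.lt_def.mp hab
        nlinarith

/-- For `k = 3` the grid superpattern is `147258369` (one-line notation `1`-based; here `0`-based values).
[cite: Arratia1999, Theorem 2 (example)] -/
theorem superpattern_three_values :
    (List.ofFn fun x : Fin (3 * 3) =>
      (((finProdFinEquiv.symm.trans ((Equiv.prodComm (Fin 3) (Fin 3)).trans finProdFinEquiv)) x : Fin (3 * 3)) : ℕ)) =
      [0, 3, 6, 1, 4, 7, 2, 5, 8] := by
  decide

end PermContainsPattern

end Literature.Combinatorics.Enumerative
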